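import Literature.Analysis.Fourier.PeriodicModeCalculus
import Mathlib.Analysis.PSeries
import Mathlib.Analysis.SpecialFunctions.ExpDeriv
import Mathlib.Analysis.Calculus.Deriv.Shift
import Mathlib.Analysis.Analytic.Constructions
import HarnessLib

/-!
# `C¹`-approximation of smooth periodic functions by trigonometric polynomials (Fourier partial sums)

Classical Fourier analysis (topic `Analysis/Fourier`), proofs plus two explicit definitions.  For a
`T`-periodic function `g : ℝ → ℂ` the symmetric Fourier partial sums

  `fourierPartial T g N x = ∑_{|n| ≤ N} ĝ(n) e^{2πinx/T}`,   `ĝ(n) = (1/T) ∫₀ᵀ e^{-2πiny/T} g(y) dy`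

are trigonometric polynomials (entire in `x`; `analyticAt_fourierPartial`), and:

* `norm_sub_fourierPartial_lt` — if `g` is continuous and `∑ |ĝ(n)| < ∞` then
  `fourierPartial T g N → g` UNIFORMLY (Mathlib's `hasSum_fourier_series_of_summable` on
  `C(AddCircle T, ℂ)`, read along the symmetric exhaustion `[-N, N]` of `ℤ`);
* `norm_trigCoeff_le_of_hasDerivAt_two`, `summable_trigCoeff_of_hasDerivAt_two` — for `g ∈ C²`
  periodic, `|ĝ(n)| ≤ (T/2π n)² · T⁻¹ ∫|g''| ≤ (sup |g''|) (T/2πn)²`, hence summable (periodic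
  integration by parts twice, the tree's `modeCoeff_hasDerivAt_hasDerivAt_eq`);
* `hasDerivAt_fourierPartial`, `trigCoeff_deriv` — `(fourierPartial T g N)' = fourierPartial T g' N`
  (`ĝ'(n) = (2πin/T) ĝ(n)`, the tree's `modeCoeff_hasDerivAt_eq`);
* **`exists_fourierPartial_C1_approx`** — for `g ∈ C³` periodic and `ε > 0` there is `N` with
  `|g - P_N| < ε` and `|g' - P_N'| < ε` everywhere, `P_N = fourierPartial T g N`
  (Katznelson, *An Introduction to Harmonic Analysis*, I.2 Cor. 2.4 / I.5; Zygmund, *Trigonometric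
  Series*, II §(2.7)): smooth periodic functions are `C¹`-limits of trigonometric polynomials;
  `exists_fourierPartial_C1_approx_eventually(_of_contDiff)` (all `N ≥ N₀`) and the vector-valued
  form with one common degree, `fourierPartialPi`, `exists_fourierPartialPi_C1_approx`,
  `analyticAt_fourierPartialPi` (closed curves in `ℂⁿ`).

Use (seat of `Literature.Geometry.Symplectic.palf_stein_supportedByBoundaryOpenBook`): real-analytic
`C¹`-approximation of the coordinates of a smooth Legendrian curve (the analytic re-approximation
step before the holomorphic collar chart, `Analysis/Complex/RealAnalyticExtension.lean`).

Everything is proved; definitions `trigCoeff`, `fourierPartial`, `circleLift`, `fourierPartialPi`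
(explicit formulas), no named fact.

## References

* Y. Katznelson, *An Introduction to Harmonic Analysis*, 3rd ed. (2004), Ch. I §2 (Cor. 2.4),
  §4. [Katznelson2004]
* A. Zygmund, *Trigonometric Series*, 3rd ed. with a foreword by R. Fefferman (2002), Ch. II §2.
  [ZygmundFefferman2003]
-/

noncomputable section

open MeasureTheory Set Filter Topology Real intervalIntegral Complex AddCircle Finset
open scoped ComplexConjugate Interval

namespace Literature.Analysis.Fourier

variable {T : ℝ}

/-! ### Coefficients and partial sums -/

variable (T) in
/-- **The `n`-th Fourier coefficient** of `g : ℝ → ℂ` on `[0, T]`: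
`ĝ(n) = (1/T) ∫₀ᵀ e^{-2πiny/T} g(y) dy` (`= T⁻¹ · modeCoeff T n g`). [folklore] -/
def trigCoeff (g : ℝ → ℂ) (n : ℤ) : ℂ :=
  (1 / (T : ℂ)) * modeCoeff T n g

variable (T) in
/-- **The symmetric Fourier partial sum** `P_N(x) = ∑_{|n| ≤ N} ĝ(n) e^{2πinx/T}`, a
trigonometric polynomial. [folklore] -/
def fourierPartial (g : ℝ → ℂ) (N : ℕ) (x : ℝ) : ℂ :=
  ∑ n ∈ Finset.Icc (-(N : ℤ)) N, trigCoeff T g n * fourier n (x : AddCircle T)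

/-- Unfolding, with the characters written as exponentials. [folklore] -/
theorem fourierPartial_eq_sum_cexp (g : ℝ → ℂ) (N : ℕ) (x : ℝ) :
    fourierPartial T g N x =
      ∑ n ∈ Finset.Icc (-(N : ℤ)) N, trigCoeff T g n * Complex.exp (2 * π * I * n * x / T) := by
  unfold fourierPartial
  refine Finset.sum_congr rfl fun n _ => ?_
  rw [fourier_coe_apply]

/-- The coefficient is the Fourier coefficient of the lift to the circle. [folklore] -/
theorem trigCoeff_eq_fourierCoeff [hT : Fact (0 < T)] (g : ℝ → ℂ) (n : ℤ) :
    trigCoeff T g n = fourierCoeff (AddCircle.liftIoc T 0 g) n := by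
  have hT0 : (T : ℂ) ≠ 0 := by exact_mod_cast hT.out.ne'
  rw [trigCoeff, modeCoeff_eq_mul_fourierCoeff, ← mul_assoc, one_div_mul_cancel hT0, one_mul]

/-! ### The lift of a continuous periodic function to the circle -/

/-- A continuous `T`-periodic function as a continuous map on `AddCircle T`. [folklore] -/
def circleLift [hT : Fact (0 < T)] (g : ℝ → ℂ) (hg : Continuous g) (hper : Function.Periodic g T) :
    C(AddCircle T, ℂ) :=
  ⟨AddCircle.liftIoc T 0 g,
    liftIoc_zero_continuous (by simpa using (hper 0).symm) hg.continuousOn⟩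

/-- The lift evaluates to `g` along the real line. [folklore] -/
theorem circleLift_coe [hT : Fact (0 < T)] {g : ℝ → ℂ} (hg : Continuous g)
    (hper : Function.Periodic g T) (x : ℝ) : circleLift g hg hper (x : AddCircle T) = g x := by
  -- reduce `x` into `(0, T]`
  set y := toIocMod hT.out 0 x with hy
  have hymem : y ∈ Ioc (0 : ℝ) (0 + T) := toIocMod_mem_Ioc hT.out 0 x
  have hxy : (x : AddCircle T) = (y : AddCircle T) := by
    have h := toIocMod_add_toIocDiv_zsmul hT.out 0 x
    -- `y + n • T = x`
    rw [← h, AddCircle.coe_add, AddCircle.coe_zsmul, AddCircle.coe_period, smul_zero, add_zero]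
  have hgy : g y = g x := by
    have h := toIocMod_add_toIocDiv_zsmul hT.out 0 x
    rw [← h]
    exact (hper.zsmul (toIocDiv hT.out 0 x) y).symm
  show AddCircle.liftIoc T 0 g (x : AddCircle T) = g x
  rw [hxy, liftIoc_coe_apply hymem, hgy]

/-- The Fourier coefficients of the lift are the `trigCoeff`s. [folklore] -/
theorem fourierCoeff_circleLift [hT : Fact (0 < T)] {g : ℝ → ℂ} (hg : Continuous g)
    (hper : Function.Periodic g T) (n : ℤ) :
    fourierCoeff (circleLift g hg hper) n = trigCoeff T g n := by
  rw [trigCoeff_eq_fourierCoeff]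
  rfl

/-! ### Uniform convergence of the symmetric partial sums -/

/-- **Uniform convergence of the Fourier partial sums** of a continuous periodic function with
summable coefficients: for every `ε > 0`, eventually `|g(x) - P_N(x)| < ε` for all `x`.
[cite: Katznelson2004, Ch. I §2, Cor. 2.4] -/
theorem norm_sub_fourierPartial_lt [hT : Fact (0 < T)] {g : ℝ → ℂ} (hg : Continuous g)
    (hper : Function.Periodic g T) (hsum : Summable (trigCoeff T g)) {ε : ℝ} (hε : 0 < ε) :
    ∃ N₀ : ℕ, ∀ N, N₀ ≤ N → ∀ x : ℝ, ‖g x - fourierPartial T g N x‖ < ε := by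
  set F := circleLift g hg hper with hF
  have hsum' : Summable (fourierCoeff F) := by
    have : fourierCoeff F = trigCoeff T g := funext fun n => fourierCoeff_circleLift hg hper n
    rwa [this]
  have hS := hasSum_fourier_series_of_summable hsum'
  -- partial sums along the symmetric exhaustion
  -- (the symmetric exhaustion `[-N, N]` of `ℤ` tends to `atTop`; cf. the tree's
  -- `Literature.Analysis.FunctionSpaces.Torus.tendsto_Icc_neg_atTop`, not imported to keep the
  -- import closure small)
  have hIcc : Tendsto (fun N : ℕ => Finset.Icc (-(N : ℤ)) N) atTop atTop := by
    refine tendsto_atTop_finset_of_monotone (fun m n hmn => ?_) fun x => ?_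
    · intro k hk
      simp only [Finset.mem_Icc] at hk ⊢
      constructor <;> omega
    · refine ⟨x.natAbs, ?_⟩
      simp only [Finset.mem_Icc]
      constructor <;> omega
  have hT' : Tendsto (fun N : ℕ => ∑ i ∈ Finset.Icc (-(N : ℤ)) N, fourierCoeff F i • fourier i)
      atTop (𝓝 F) := hS.comp hIcc
  rw [Metric.tendsto_atTop] at hT'
  obtain ⟨N₀, hN₀⟩ := hT' ε hε
  refine ⟨N₀, fun N hN x => ?_⟩
  set S : C(AddCircle T, ℂ) := ∑ i ∈ Finset.Icc (-(N : ℤ)) N, fourierCoeff F i • fourier i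
    with hSdef
  have hdist : dist S F < ε := hN₀ N hN
  rw [dist_eq_norm] at hdist
  -- evaluate at the point `x`
  have hx := (S - F).norm_coe_le_norm (x : AddCircle T)
  have heval : (S - F) (x : AddCircle T) = fourierPartial T g N x - g x := by
    rw [ContinuousMap.sub_apply, hSdef, ContinuousMap.coe_sum, Finset.sum_apply, hF,
      circleLift_coe hg hper]
    unfold fourierPartial
    congr 1
    refine Finset.sum_congr rfl fun n _ => ?_
    rw [ContinuousMap.smul_apply, smul_eq_mul, ← hF, fourierCoeff_circleLift hg hper]
  rw [heval] at hx
  rw [norm_sub_rev]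
  exact hx.trans_lt hdist

/-! ### Decay of the coefficients of a `C²` function -/

/-- A bound for the modes of a bounded function: `|∫₀ᵀ e_{-n} h| ≤ M T` if `|h| ≤ M` on `[0, T]`.
[folklore] -/
theorem norm_modeCoeff_le (hT : 0 < T) (n : ℤ) {h : ℝ → ℂ} {M : ℝ}
    (hM : ∀ y ∈ Icc 0 T, ‖h y‖ ≤ M) : ‖modeCoeff T n h‖ ≤ M * T := by
  rw [modeCoeff]
  have hb : ∀ y ∈ Ι (0 : ℝ) T, ‖fourier (-n) (y : AddCircle T) * h y‖ ≤ M := by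
    intro y hy
    rw [uIoc_of_le hT.le] at hy
    rw [norm_mul, fourier_apply, Circle.norm_coe, one_mul]
    exact hM y ⟨hy.1.le, hy.2⟩
  have := intervalIntegral.norm_integral_le_of_norm_le_const hb
  rwa [sub_zero, abs_of_pos hT] at this

/-- **Decay `|ĝ(n)| ≤ M (T / 2π n)²`** for a `T`-periodic `g` with two derivatives, `|g''| ≤ M`
(periodic integration by parts twice). [cite: Katznelson2004, Ch. I §4] -/
theorem norm_trigCoeff_le_of_hasDerivAt_two [hT : Fact (0 < T)] {g g' g'' : ℝ → ℂ}
    (hg : ∀ x, HasDerivAt g (g' x) x) (hg' : ∀ x, HasDerivAt g' (g'' x) x) (hg'' : Continuous g'')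
    (hper : Function.Periodic g T) (hper' : Function.Periodic g' T) {M : ℝ}
    (hM : ∀ y ∈ Icc 0 T, ‖g'' y‖ ≤ M) {n : ℤ} (hn : n ≠ 0) :
    ‖trigCoeff T g n‖ ≤ M * (T / (2 * π * n)) ^ 2 := by
  have hT0 : 0 < T := hT.out
  have key := modeCoeff_hasDerivAt_hasDerivAt_eq (T := T) n (fun x _ => hg x) (fun x _ => hg' x)
    (hg''.intervalIntegrable _ _) (by simpa using hper 0) (by simpa using hper' 0)
  -- `modeCoeff n g = -(T/2πn)² modeCoeff n g''`
  have hc : ((2 * π * n / T) ^ 2 : ℝ) ≠ 0 := by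
    have : (2 * π * n / T : ℝ) ≠ 0 := by
      have hn' : (n : ℝ) ≠ 0 := by exact_mod_cast hn
      positivity
    positivity
  have hsolve : modeCoeff T n g = -((1 / (2 * π * n / T) ^ 2 : ℝ) : ℂ) * modeCoeff T n g'' := by
    have hcc : (((1 / (2 * π * n / T) ^ 2 : ℝ)) : ℂ) * (((2 * π * n / T) ^ 2 : ℝ) : ℂ) = 1 := by
      rw [← Complex.ofReal_mul, one_div_mul_cancel hc, Complex.ofReal_one]
    rw [key, ← mul_assoc, neg_mul_neg, hcc, one_mul]
  have hmode : ‖modeCoeff T n g‖ ≤ (1 / (2 * π * n / T) ^ 2) * (M * T) := by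
    rw [hsolve, norm_mul, norm_neg, Complex.norm_real, Real.norm_eq_abs,
      abs_of_pos (by positivity)]
    exact mul_le_mul_of_nonneg_left (norm_modeCoeff_le hT0 n hM) (by positivity)
  have hT0' : (T : ℂ) ≠ 0 := by exact_mod_cast hT0.ne'
  rw [trigCoeff, norm_mul, norm_div, norm_one, Complex.norm_real, Real.norm_eq_abs, abs_of_pos hT0]
  calc 1 / T * ‖modeCoeff T n g‖ ≤ 1 / T * ((1 / (2 * π * n / T) ^ 2) * (M * T)) :=
        mul_le_mul_of_nonneg_left hmode (by positivity)
    _ = M * (T / (2 * π * n)) ^ 2 := by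
        have hn' : (n : ℝ) ≠ 0 := by exact_mod_cast hn
        field_simp

/-- **Summability of the Fourier coefficients of a `C²` periodic function.**
[cite: Katznelson2004, Ch. I §4] -/
theorem summable_trigCoeff_of_hasDerivAt_two [hT : Fact (0 < T)] {g g' g'' : ℝ → ℂ}
    (hg : ∀ x, HasDerivAt g (g' x) x) (hg' : ∀ x, HasDerivAt g' (g'' x) x) (hg'' : Continuous g'')
    (hper : Function.Periodic g T) (hper' : Function.Periodic g' T) :
    Summable (trigCoeff T g) := by
  -- a bound for `g''` on `[0, T]`
  obtain ⟨M, hM⟩ := isCompact_Icc.exists_bound_of_continuousOn (hg''.continuousOn (s := Icc 0 T))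
  have hdecay : ∀ n : ℤ, n ≠ 0 → ‖trigCoeff T g n‖ ≤ M * (T / (2 * π * n)) ^ 2 := fun n hn =>
    norm_trigCoeff_le_of_hasDerivAt_two hg hg' hg'' hper hper' hM hn
  -- comparison with `C / n²`
  have hsum : Summable fun n : ℤ => M * (T / (2 * π)) ^ 2 * (1 / (n : ℝ) ^ 2) :=
    (summable_one_div_int_pow.2 one_lt_two).mul_left _
  refine Summable.of_norm_bounded_eventually hsum ?_
  have hcof : ∀ᶠ n : ℤ in cofinite, n ≠ 0 := eventually_cofinite_ne 0
  filter_upwards [hcof] with n hn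
  have hn' : (n : ℝ) ≠ 0 := by exact_mod_cast hn
  calc ‖trigCoeff T g n‖ ≤ M * (T / (2 * π * n)) ^ 2 := hdecay n hn
    _ = M * (T / (2 * π)) ^ 2 * (1 / (n : ℝ) ^ 2) := by
        field_simp

/-! ### Derivatives of the partial sums -/

/-- **Coefficients of the derivative**: `ĝ'(n) = (2πin/T) ĝ(n)` for periodic `g`.
[cite: Katznelson2004, Ch. I §4] -/
theorem trigCoeff_deriv {g g' : ℝ → ℂ} (hg : ∀ x, HasDerivAt g (g' x) x) (hg'c : Continuous g')
    (hper : Function.Periodic g T) (n : ℤ) :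
    trigCoeff T g' n = (2 * π * I * n / T) * trigCoeff T g n := by
  rw [trigCoeff, trigCoeff, modeCoeff_hasDerivAt_eq n (fun x _ => hg x) (hg'c.intervalIntegrable _ _)
    (by simpa using hper 0)]
  ring

/-- **The derivative of the partial sum is the partial sum of the derivative's series**:
`P_N' (x) = ∑_{|n| ≤ N} (2πin/T) ĝ(n) e^{2πinx/T}`. [folklore] -/
theorem hasDerivAt_fourierPartial (g : ℝ → ℂ) (N : ℕ) (x : ℝ) :
    HasDerivAt (fourierPartial T g N)
      (∑ n ∈ Finset.Icc (-(N : ℤ)) N,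
        trigCoeff T g n * (2 * π * I * n / T * fourier n (x : AddCircle T))) x := by
  unfold fourierPartial
  refine HasDerivAt.fun_sum fun n _ => ?_
  exact (hasDerivAt_fourier T n x).const_mul (trigCoeff T g n)

/-- Hence `P_N(g)' = P_N(g')` for periodic `g ∈ C¹`. [cite: Katznelson2004, Ch. I §4] -/
theorem hasDerivAt_fourierPartial_eq {g g' : ℝ → ℂ} (hg : ∀ x, HasDerivAt g (g' x) x)
    (hg'c : Continuous g') (hper : Function.Periodic g T) (N : ℕ) (x : ℝ) :
    HasDerivAt (fourierPartial T g N) (fourierPartial T g' N x) x := by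
  have h := hasDerivAt_fourierPartial (T := T) g N x
  have heq : (∑ n ∈ Finset.Icc (-(N : ℤ)) N,
      trigCoeff T g n * (2 * π * I * n / T * fourier n (x : AddCircle T))) =
      fourierPartial T g' N x := by
    unfold fourierPartial
    refine Finset.sum_congr rfl fun n _ => ?_
    rw [trigCoeff_deriv hg hg'c hper n]
    ring
  rw [heq] at h
  exact h

/-- `deriv` form. [folklore] -/
theorem deriv_fourierPartial_eq {g g' : ℝ → ℂ} (hg : ∀ x, HasDerivAt g (g' x) x)
    (hg'c : Continuous g') (hper : Function.Periodic g T) (N : ℕ) (x : ℝ) :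
    deriv (fourierPartial T g N) x = fourierPartial T g' N x :=
  (hasDerivAt_fourierPartial_eq hg hg'c hper N x).deriv

/-! ### The `C¹` approximation theorem -/

/-- The derivative of a periodic function is periodic (explicit-derivative form). [folklore] -/
theorem periodic_of_hasDerivAt {g g' : ℝ → ℂ} (hg : ∀ x, HasDerivAt g (g' x) x)
    (hper : Function.Periodic g T) : Function.Periodic g' T := by
  intro x
  have h1 : HasDerivAt (fun y => g (y + T)) (g' (x + T)) x := HasDerivAt.comp_add_const x T (hg (x + T))
  have hfun : (fun y => g (y + T)) = g := funext hper
  rw [hfun] at h1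
  exact h1.unique (hg x)

/-- **`C¹`-approximation of a `C³` periodic function by its Fourier partial sums.**  Let `g` be
`T`-periodic with three derivatives `g', g'', g'''`, the last continuous.  Then for every
`ε > 0` there is `N` such that for all `x`:
`|g(x) - P_N(x)| < ε` and `|g'(x) - P_N'(x)| < ε`, where `P_N = fourierPartial T g N` and
`P_N' = fourierPartial T g' N` is its derivative. [cite: Katznelson2004, Ch. I §2 Cor. 2.4 & §4] -/
theorem exists_fourierPartial_C1_approx [hT : Fact (0 < T)] {g g' g'' g''' : ℝ → ℂ}
    (hg : ∀ x, HasDerivAt g (g' x) x) (hg' : ∀ x, HasDerivAt g' (g'' x) x)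
    (hg'' : ∀ x, HasDerivAt g'' (g''' x) x) (hg''' : Continuous g''')
    (hper : Function.Periodic g T) {ε : ℝ} (hε : 0 < ε) :
    ∃ N : ℕ, (∀ x, ‖g x - fourierPartial T g N x‖ < ε) ∧
      (∀ x, HasDerivAt (fourierPartial T g N) (fourierPartial T g' N x) x) ∧
      ∀ x, ‖g' x - fourierPartial T g' N x‖ < ε := by
  -- continuity and periodicity of the derivatives
  have hgc : Continuous g := continuous_iff_continuousAt.2 fun x => (hg x).continuousAt
  have hg'c : Continuous g' := continuous_iff_continuousAt.2 fun x => (hg' x).continuousAt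
  have hg''c : Continuous g'' := continuous_iff_continuousAt.2 fun x => (hg'' x).continuousAt
  have hper' : Function.Periodic g' T := periodic_of_hasDerivAt hg hper
  have hper'' : Function.Periodic g'' T := periodic_of_hasDerivAt hg' hper'
  -- summability of both coefficient sequences
  have hs : Summable (trigCoeff T g) := summable_trigCoeff_of_hasDerivAt_two hg hg' hg''c hper hper'
  have hs' : Summable (trigCoeff T g') :=
    summable_trigCoeff_of_hasDerivAt_two hg' hg'' hg''' hper' hper''
  obtain ⟨N₁, hN₁⟩ := norm_sub_fourierPartial_lt hgc hper hs hε
  obtain ⟨N₂, hN₂⟩ := norm_sub_fourierPartial_lt hg'c hper' hs' hε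
  refine ⟨max N₁ N₂, fun x => hN₁ _ (le_max_left _ _) x,
    fun x => hasDerivAt_fourierPartial_eq hg hg'c hper _ x, fun x => hN₂ _ (le_max_right _ _) x⟩

/-- `ContDiff` form: a `C³` `T`-periodic `g : ℝ → ℂ` is `C¹`-approximated, uniformly, by its
Fourier partial sums. [cite: Katznelson2004, Ch. I §2 Cor. 2.4 & §4] -/
theorem exists_fourierPartial_C1_approx_of_contDiff [hT : Fact (0 < T)] {g : ℝ → ℂ}
    (hg : ContDiff ℝ 3 g) (hper : Function.Periodic g T) {ε : ℝ} (hε : 0 < ε) :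
    ∃ N : ℕ, (∀ x, ‖g x - fourierPartial T g N x‖ < ε) ∧
      (∀ x, HasDerivAt (fourierPartial T g N) (fourierPartial T (deriv g) N x) x) ∧
      ∀ x, ‖deriv g x - fourierPartial T (deriv g) N x‖ < ε := by
  have h1 : ContDiff ℝ 2 (deriv g) := by
    have := hg.iterate_deriv' 2 1
    simpa using this
  have h2 : ContDiff ℝ 1 (deriv^[2] g) := by
    have := hg.iterate_deriv' 1 2
    simpa using this
  have h3 : ContDiff ℝ 0 (deriv^[3] g) := by
    have := hg.iterate_deriv' 0 3
    simpa using this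
  have hd0 : ∀ x, HasDerivAt g (deriv g x) x := fun x =>
    (hg.differentiable (by norm_num) x).hasDerivAt
  have hd1 : ∀ x, HasDerivAt (deriv g) (deriv^[2] g x) x := fun x => by
    have := (h1.differentiable (by norm_num) x).hasDerivAt
    simpa [Function.iterate_succ_apply'] using this
  have hd2 : ∀ x, HasDerivAt (deriv^[2] g) (deriv^[3] g x) x := fun x => by
    have := (h2.differentiable (by norm_num) x).hasDerivAt
    simpa [Function.iterate_succ_apply'] using this
  exact exists_fourierPartial_C1_approx hd0 hd1 hd2 h3.continuous hper hε

/-! ### The partial sums are real-analytic (entire) -/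

/-- Each character `x ↦ e^{2πinx/T}` is real-analytic on `ℝ` (as a `ℂ`-valued function).
[folklore] -/
theorem analyticAt_fourier_coe (n : ℤ) (x : ℝ) :
    AnalyticAt ℝ (fun y : ℝ => fourier n (y : AddCircle T)) x := by
  have hfun : (fun y : ℝ => fourier n (y : AddCircle T)) =
      fun y : ℝ => Complex.exp (2 * π * I * n * (y : ℂ) / T) := by
    funext y
    rw [fourier_coe_apply]
  rw [hfun]
  have hin : AnalyticAt ℝ (fun y : ℝ => 2 * π * I * n * (y : ℂ) / T) x := by
    have h1 : AnalyticAt ℝ (fun y : ℝ => (y : ℂ)) x := Complex.ofRealCLM.analyticAt x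
    exact (analyticAt_const.mul h1).div_const
  exact (analyticAt_cexp.restrictScalars (𝕜 := ℝ)).comp hin

/-- **The Fourier partial sums are real-analytic** (trigonometric polynomials). [folklore] -/
theorem analyticAt_fourierPartial (g : ℝ → ℂ) (N : ℕ) (x : ℝ) :
    AnalyticAt ℝ (fourierPartial T g N) x := by
  have hfun : fourierPartial T g N =
      ∑ n ∈ Finset.Icc (-(N : ℤ)) N, fun y : ℝ => trigCoeff T g n * fourier n ((y : ℝ) : AddCircle T) := by
    funext y
    simp [fourierPartial, Finset.sum_apply]
  rw [hfun]
  exact Finset.analyticAt_sum _ fun n _ => analyticAt_const.mul (analyticAt_fourier_coe n x)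

/-! ### Eventual form and vector-valued (componentwise) form -/

/-- **Eventual form** of the `C¹` approximation: for `g` `T`-periodic with three derivatives, the
last continuous, and `ε > 0`, ALL partial sums `P_N`, `N ≥ N₀`, are `ε`-close to `g` in `C¹`.
[cite: Katznelson2004, Ch. I §2 Cor. 2.4 & §4] -/
theorem exists_fourierPartial_C1_approx_eventually [hT : Fact (0 < T)] {g g' g'' g''' : ℝ → ℂ}
    (hg : ∀ x, HasDerivAt g (g' x) x) (hg' : ∀ x, HasDerivAt g' (g'' x) x)
    (hg'' : ∀ x, HasDerivAt g'' (g''' x) x) (hg''' : Continuous g''')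
    (hper : Function.Periodic g T) {ε : ℝ} (hε : 0 < ε) :
    ∃ N₀ : ℕ, ∀ N, N₀ ≤ N → (∀ x, ‖g x - fourierPartial T g N x‖ < ε) ∧
      (∀ x, HasDerivAt (fourierPartial T g N) (fourierPartial T g' N x) x) ∧
      ∀ x, ‖g' x - fourierPartial T g' N x‖ < ε := by
  have hgc : Continuous g := continuous_iff_continuousAt.2 fun x => (hg x).continuousAt
  have hg'c : Continuous g' := continuous_iff_continuousAt.2 fun x => (hg' x).continuousAt
  have hg''c : Continuous g'' := continuous_iff_continuousAt.2 fun x => (hg'' x).continuousAt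
  have hper' : Function.Periodic g' T := periodic_of_hasDerivAt hg hper
  have hper'' : Function.Periodic g'' T := periodic_of_hasDerivAt hg' hper'
  have hs : Summable (trigCoeff T g) := summable_trigCoeff_of_hasDerivAt_two hg hg' hg''c hper hper'
  have hs' : Summable (trigCoeff T g') :=
    summable_trigCoeff_of_hasDerivAt_two hg' hg'' hg''' hper' hper''
  obtain ⟨N₁, hN₁⟩ := norm_sub_fourierPartial_lt hgc hper hs hε
  obtain ⟨N₂, hN₂⟩ := norm_sub_fourierPartial_lt hg'c hper' hs' hε
  refine ⟨max N₁ N₂, fun N hN => ⟨fun x => hN₁ N ((le_max_left _ _).trans hN) x,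
    fun x => hasDerivAt_fourierPartial_eq hg hg'c hper N x,
    fun x => hN₂ N ((le_max_right _ _).trans hN) x⟩⟩

/-- Eventual `ContDiff` form. [cite: Katznelson2004, Ch. I §2 Cor. 2.4 & §4] -/
theorem exists_fourierPartial_C1_approx_eventually_of_contDiff [hT : Fact (0 < T)] {g : ℝ → ℂ}
    (hg : ContDiff ℝ 3 g) (hper : Function.Periodic g T) {ε : ℝ} (hε : 0 < ε) :
    ∃ N₀ : ℕ, ∀ N, N₀ ≤ N → (∀ x, ‖g x - fourierPartial T g N x‖ < ε) ∧
      (∀ x, HasDerivAt (fourierPartial T g N) (fourierPartial T (deriv g) N x) x) ∧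
      ∀ x, ‖deriv g x - fourierPartial T (deriv g) N x‖ < ε := by
  have h1 : ContDiff ℝ 2 (deriv g) := by
    have := hg.iterate_deriv' 2 1
    simpa using this
  have h2 : ContDiff ℝ 1 (deriv^[2] g) := by
    have := hg.iterate_deriv' 1 2
    simpa using this
  have h3 : ContDiff ℝ 0 (deriv^[3] g) := by
    have := hg.iterate_deriv' 0 3
    simpa using this
  have hd0 : ∀ x, HasDerivAt g (deriv g x) x := fun x =>
    (hg.differentiable (by norm_num) x).hasDerivAt
  have hd1 : ∀ x, HasDerivAt (deriv g) (deriv^[2] g x) x := fun x => by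
    have := (h1.differentiable (by norm_num) x).hasDerivAt
    simpa [Function.iterate_succ_apply'] using this
  have hd2 : ∀ x, HasDerivAt (deriv^[2] g) (deriv^[3] g x) x := fun x => by
    have := (h2.differentiable (by norm_num) x).hasDerivAt
    simpa [Function.iterate_succ_apply'] using this
  exact exists_fourierPartial_C1_approx_eventually hd0 hd1 hd2 h3.continuous hper hε

variable (T) in
/-- **Componentwise partial sums** of a vector-valued `g : ℝ → ι → ℂ` (e.g. the coordinates of a
closed curve in `ℂⁿ`). [folklore] -/
def fourierPartialPi {ι : Type*} (g : ℝ → ι → ℂ) (N : ℕ) (x : ℝ) : ι → ℂ :=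
  fun i => fourierPartial T (fun t => g t i) N x

/-- Unfolding. [folklore] -/
theorem fourierPartialPi_apply {ι : Type*} (g : ℝ → ι → ℂ) (N : ℕ) (x : ℝ) (i : ι) :
    fourierPartialPi T g N x i = fourierPartial T (fun t => g t i) N x := rfl

/-- **Vector-valued `C¹` approximation with one common degree**: for finitely many `C³`
`T`-periodic components there is `N` such that every component and its derivative are `ε`-close
to the componentwise partial sums of degree `N` (trigonometric-polynomial curves are `C¹`-dense in
smooth closed curves). [cite: Katznelson2004, Ch. I §2 Cor. 2.4 & §4] -/
theorem exists_fourierPartialPi_C1_approx {ι : Type*} [Fintype ι] [hT : Fact (0 < T)]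
    {g : ℝ → ι → ℂ} (hg : ∀ i, ContDiff ℝ 3 fun t => g t i)
    (hper : ∀ i, Function.Periodic (fun t => g t i) T) {ε : ℝ} (hε : 0 < ε) :
    ∃ N : ℕ, (∀ i x, ‖g x i - fourierPartialPi T g N x i‖ < ε) ∧
      (∀ i x, HasDerivAt (fun t => fourierPartialPi T g N t i)
        (fourierPartialPi T (fun t j => deriv (fun s => g s j) t) N x i) x) ∧
      ∀ i x, ‖deriv (fun s => g s i) x -
        fourierPartialPi T (fun t j => deriv (fun s => g s j) t) N x i‖ < ε := by
  classical
  choose N₀ hN₀ using fun i => exists_fourierPartial_C1_approx_eventually_of_contDiff (hg i) (hper i) hε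
  refine ⟨Finset.univ.sup N₀, fun i x => ?_, fun i x => ?_, fun i x => ?_⟩
  · exact (hN₀ i _ (Finset.le_sup (Finset.mem_univ i))).1 x
  · exact (hN₀ i _ (Finset.le_sup (Finset.mem_univ i))).2.1 x
  · exact (hN₀ i _ (Finset.le_sup (Finset.mem_univ i))).2.2 x

/-- The componentwise partial sums are real-analytic in each component. [folklore] -/
theorem analyticAt_fourierPartialPi_apply {ι : Type*} (g : ℝ → ι → ℂ) (N : ℕ) (x : ℝ) (i : ι) :
    AnalyticAt ℝ (fun t => fourierPartialPi T g N t i) x :=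
  analyticAt_fourierPartial (fun t => g t i) N x

/-- The componentwise partial sums are real-analytic as a map into `ι → ℂ`. [folklore] -/
theorem analyticAt_fourierPartialPi {ι : Type*} [Fintype ι] (g : ℝ → ι → ℂ) (N : ℕ) (x : ℝ) :
    AnalyticAt ℝ (fourierPartialPi T g N) x := by
  rw [analyticAt_pi_iff]
  intro i
  exact analyticAt_fourierPartialPi_apply g N x i

end Literature.Analysis.Fourier

end
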